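import Summits.CriticalPhenomena.CardyFormulaZ2.Theorems.CardyFlipRussoCoveringLegShiftDefs
import Summits.CriticalPhenomena.CardyFormulaZ2.Theorems.CardyFlipRussoCoveringLegStubRussoQDerivative
import HarnessLib

/-!
# Stub `stub_russoShift` (S4') of line `five-arm-null` (skeleton v3, shifted family) for the crux `CardyFlipRusso.CoveringLeg`

Route `CardyFlipRusso`, sub-problem `CriticalPhenomena/CardyFormulaZ2`, crux item stmt-CriticalPhenomena-6435
(`Summit.CriticalPhenomena.CardyFormulaZ2.Theses.CardyFlipRusso.CoveringLeg`), skeleton v3 "shifted family"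
`Cruxes/CoveringLeg/Lines/five_arm_null.lean` (lead `prover-line-stmt-CriticalPhenomena-6435-c1-0`), registered
stub S4' `stub_russoShift : Sig.stub_russoShift`, i.e. `PivotalBalanceShift → MixedInterpolationShift`
(`stub_russoShift_iff`).

Mathematics (V. Beffara, *Is critical 2D percolation universal?* (2008), §5.2, Prop. 18 = Russo's formula in `q`
for the mixed law `P_{1/2,q} = prodBernoulli (mixedParam q)` on the centred square lattice `G_s`, plus the mean
value theorem).  Everything happens AT A FIXED MESH `δ`, for the translated rectangle
`R ⊕ δc := R.map (similarity 1 _ (δ · i/√2))`: the crude crossing event `crossS (R ⊕ δc) δ` is the tree's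
`siteEmbDomainCrossing gsGraph zS (R ⊕ δc).carrier δ ((R ⊕ δc).arc 0) ((R ⊕ δc).arc 2)` (`crossS_eq`, `rfl`), its
window is finite because the translated carrier is bounded (`russo_window_finite`), and the landed per-mesh form
of Prop. 18 + MVT (`russo_abs_sub_lt`, p116769, fully general in the domain and the arcs) turns
`sup_q |Σ_{II} P_q(piv) − Σ_{III} P_q(piv)| < ε` for `(R ⊕ δc, δ)` into `|P_{1/2}[cross] − P_0[cross]| < ε` for
`(R ⊕ δc, δ)` (`russoShift_abs_sub_lt`).  If the former holds for all `δ < δ₀` (`PivotalBalanceShift`), the latter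
gives `P_{1/2}[cross] − P_0[cross] → 0` as `δ → 0⁺` along the shifted family (`MixedInterpolationShift`):
`Metric.tendsto_nhds` + `Ioo_mem_nhdsGT`.

## References

* V. Beffara, *Is critical 2D percolation universal?*, In and Out of Equilibrium 2, Progr. Probab. 60 (2008),
  §5.2, Prop. 18. [Beffara2008Universal]
* L. Russo, *On the critical percolation probabilities*, Z. Wahrsch. verw. Gebiete 56 (1981), §4 Lemma 3.
  [RussoZW1981]
-/

noncomputable section

namespace Summit.CriticalPhenomena.CardyFormulaZ2.Cruxes.CoveringLeg.FiveArmNull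

open Filter Set Topology
open Literature.Probability.RandomPlanarGeometry Literature.Probability.Percolation
open Literature.Probability.LatticeModels
open Literature.Barriers.CriticalPhenomena (MixedSite mixedParam)
open Summit.CriticalPhenomena.CardyFormulaZ2.Theses

/-- **Window finiteness for an arbitrary conformal rectangle** in the covering-adapted frame `zS`: at mesh
`δ > 0` only finitely many type-I sites and finitely many face centres of `G_s` are mapped into `R` (applied
below to the translate `R ⊕ δc`, whose carrier is again bounded). [cite: Beffara2008Universal, §5.1] -/
theorem russoShift_window_finite (R : ConformalRectangle) {δ : ℝ} (hδ : 0 < δ) :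
    {x : ℤ × ℤ | (δ : ℂ) * zS (Sum.inl x) ∈ R.carrier}.Finite ∧
      {f : ℤ × ℤ | (δ : ℂ) * zS (Sum.inr f) ∈ R.carrier}.Finite :=
  russo_window_finite R.isBounded hδ

/-- **Beffara's Prop. 18 + MVT at a fixed mesh, in the line's vocabulary**: for ANY conformal rectangle `R`
(in particular a `δ`-dependent translate) and mesh `δ > 0`, if `|massII R q δ − massIII R q δ| < ε` for every
`q ∈ [0,1]`, then `|(lawP ½).real (crossS R δ) − (lawP 0).real (crossS R δ)| < ε`.  This is `russo_abs_sub_lt`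
with `G := gsGraph`, `z := zS`, `Ω := R.carrier`, `A := R.arc 0`, `B := R.arc 2` (all identifications `rfl`:
`crossS_eq`, `pivS`, `massII`, `massIII`, `lawP`). [cite: Beffara2008Universal, §5.2 Prop. 18] -/
theorem russoShift_abs_sub_lt (R : ConformalRectangle) {δ : ℝ} (hδ : 0 < δ) {ε : ℝ}
    (hV : ∀ q : unitInterval, |massII R q δ - massIII R q δ| < ε) :
    |(lawP half).real (crossS R δ) - (lawP 0).real (crossS R δ)| < ε := by
  obtain ⟨h1, h2⟩ := russoShift_window_finite R hδ
  exact russo_abs_sub_lt gsGraph zS R.carrier (R.arc 0) (R.arc 2) δ h1 h2 hV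

/-- **S4' in expanded form**: the pivotal balance along the shifted family (`PivotalBalanceShift`, Beffara's
eq. (5.1) for the anchoring `R ⊕ δ·i/√2`) implies the interpolation `P_{1/2}[cross] − P_0[cross] → 0` along the
shifted family (`MixedInterpolationShift`): at each mesh `δ ∈ (0, δ₀)` apply `russoShift_abs_sub_lt` to the
translate `R ⊕ δc`. [cite: Beffara2008Universal, §5.2 Prop. 18] -/
theorem mixedInterpolationShift_of_pivotalBalanceShift (hB : PivotalBalanceShift) :
    MixedInterpolationShift := by
  intro R
  rw [Metric.tendsto_nhds]
  intro ε hε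
  obtain ⟨δ₀, hδ₀, hδ⟩ := hB R ε hε
  filter_upwards [Ioo_mem_nhdsGT hδ₀] with δ hδmem
  rw [Real.dist_0_eq_abs]
  exact russoShift_abs_sub_lt _ hδmem.1 (hδ δ hδmem.1 hδmem.2)

/-- **Registered stub `stub_russoShift` (S4' of skeleton v3) — PROVED**: Russo's formula in `q` (Beffara's
Prop. 18) and the mean value theorem at each fixed mesh, applied to the translated rectangle `R ⊕ δ·i/√2`, turn
`PivotalBalanceShift` into `MixedInterpolationShift`. [cite: Beffara2008Universal, §5.2 Prop. 18] -/
theorem stub_russoShift :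
    Summit.CriticalPhenomena.CardyFormulaZ2.Cruxes.CoveringLeg.FiveArmNull.Sig.stub_russoShift :=
  fun hB => mixedInterpolationShift_of_pivotalBalanceShift hB

end Summit.CriticalPhenomena.CardyFormulaZ2.Cruxes.CoveringLeg.FiveArmNull

end
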